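import Summits.BirchSwinnertonDyer.BirchSwinnertonDyer.Theorems.SignedLowerHalvesSmallImageLowerHalfBothSignsRttLineJunctionExact
import Summits.BirchSwinnertonDyer.BirchSwinnertonDyer.Theorems.SignedLowerHalvesSmallImageLowerHalfBothSignsRttLineJunctionRecipMT
import HarnessLib

/-!
# PORT P4 (LEAD g16): the ROWS ASSEMBLED — `charRoadJunction_ns_of_rows` (carrier, specialisation, strict sub-carrier, depletion, Euler identity, exactness, λ-inequality, reciprocity)

File 4 of the port (see P1; uses P1 and P3). THEOREMS ONLY, no `sorry`; CONDITIONAL on the displayed print facts; BSD / crux L NOT proved.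
-/

set_option autoImplicit false
-- D-0017: single-problem summit, the namespace repeats the problem name by design.
set_option linter.dupNamespace false
noncomputable section

open scoped Classical MatrixGroups ModularForm BigOperators Pointwise

namespace Summit.BirchSwinnertonDyer.BirchSwinnertonDyer.Theorems.SmallImageRttLine

open CongruenceSubgroup WeierstrassCurve Field Polynomial NumberField IsDedekindDomain Matrix
  Literature.NumberTheory.GaloisRepresentations Literature.NumberTheory.LFunctions
  Literature.NumberTheory.GaloisRepresentations.HeckeCharacter Literature.NumberTheory.Automorphic
  Summit.BirchSwinnertonDyer.BirchSwinnertonDyer.Theorems.HeckeThetaPartner Summit.BirchSwinnertonDyer.Rank1Residual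
  Literature.NumberTheory.EllipticCurves Literature.NumberTheory.EllipticCurves.ModularForms
  Literature.NumberTheory.EllipticCurves.Rank1Residual
  Literature.NumberTheory.EllipticCurves.Kobayashi2003
  Literature.NumberTheory.EllipticCurves.GreenbergVatsal2000 ZpExtension
  Literature.NumberTheory.IwasawaTheory Rat.HeightOneSpectrum
  Summit.BirchSwinnertonDyer.Rank1Residual.Supersingular
  Summit.BirchSwinnertonDyer.Rank1Residual.X1.MuLambda
  Summit.BirchSwinnertonDyer.BirchSwinnertonDyer.Theorems.SmallImageLambdaLowerThreeNsThetaTransport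
  Summit.BirchSwinnertonDyer.BirchSwinnertonDyer.Theorems

set_option maxHeartbeats 4000000 in
/-- **PORT (LEAD g16) of row B′ (assembly of rows S1·S1c·S2·S3α·S3β·S4′·S4″) of the line file `Cruxes/SmallImageLowerHalfBothSigns/Lines/rtt_w3.lean`
(v46, registered 74b28541a9c1) into the THEOREMS tree**, with the line-file predicates (`CharRoadFrameProps`, `CharRoadFrameSupp`, `CharRoad*`,
`Junction*`) UNFOLDED textually (generator `gen_port.py`; the proof is the line file's, verbatim). the depleted junction `(I, s, B′, E, s′)` with the
Kobayashi tails, from the rows (P1 `junctionExact_ns`, P3 `junctionRecipMT_ns`, and the landed S1/S1c/S3α/S3β files). Helper `--supports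
stmt-BirchSwinnertonDyer-23599`; CONDITIONAL on its displayed print-fact premises; closes nothing; crux L / BSD are NOT proved by this. [cite:
Kobayashi2003, Thm. 7.3 i)] [cite: JohnsonLeungKings2011, Thm. 5.2, Cor. 5.3] -/
theorem charRoadJunction_ns_of_rows :
    Literature.NumberTheory.EllipticCurves.ModularForms.Ribet1977_cmNewform_gamma0_eulerFactor_padicCharacter → KimPark2017.prop212_prop33_localSignedDual_free_rank_two → KimPark2017.def210_prop212_exists_signedNormSystem → KimPark2017.def210_prop29_exists_signedNormSystem_logSum → Literature.NumberTheory.EllipticCurves.Kato2004.CM.prop159_ellipticUnits_tatePairing_values_inert →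
    Literature.NumberTheory.EllipticCurves.ModularForms.Ribet1977_cmNewform_gamma0_badEulerFactor_padicCharacter → (∀ (W : WeierstrassCurve ℚ) [W.IsElliptic] [W.IsGloballyMinimal] (p : ℕ) [Fact p.Prime], ∀ (hp : p ≠ 2), ClassX7 W p → ¬ W.HasCM → W.frobeniusTrace p = 0 → ¬ Surj W p → ¬ (∃ (A : WeierstrassCurve ℚ) (_ : A.IsElliptic) (_ : A.IsGloballyMinimal), A.HasCM ∧ GoodSS A p ∧ A.frobeniusTrace p = 0 ∧ ∃ e : geomTorsion W (p : ℤ) ≃+ geomTorsion A (p : ℤ),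
                ∀ (σ : absoluteGaloisGroup ℚ) (P : geomTorsion W (p : ℤ)), e (σ • P) = σ • e P) → ¬ (∃ (A : WeierstrassCurve ℚ) (_ : A.IsElliptic) (_ : A.IsGloballyMinimal) (t : ℚ), A.HasGoodReductionAtPrime p ∧ A.frobeniusTrace p = 0 ∧ (∃ e : geomTorsion W (p : ℤ) ≃+ geomTorsion A (p : ℤ), ∀ (σ : absoluteGaloisGroup ℚ) (P : geomTorsion W (p : ℤ)), e (σ • P) = σ • e P) ∧ A.entireLFunction 1 / (A.realPeriodRat : ℂ) = ((t : ℚ) : ℂ) ∧ t ≠ 0 ∧ padicValRat p t = 0) →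
          ∀ (ε : ℤˣ) (K : Type) [Field K] [NumberField K] (σK : K →+* ℂ) (𝔪 : Ideal (𝓞 K)) (ψ : HeightOneSpectrum (𝓞 K) → ℂ) (e : PadicAlgCl p ≃+* ℂ), ∀ (hK2 : Module.finrank ℚ K = 2), IsTotallyComplex K → 𝔪 ≠ ⊥ → (∀ I : Ideal (𝓞 K), Ideal.absNorm I ≠ p) → ¬ p ∣ (NumberField.discr K).natAbs * Ideal.absNorm 𝔪 → (∀ (ℓ : ℕ) [Fact ℓ.Prime], ℓ ∣ (NumberField.discr K).natAbs * Ideal.absNorm 𝔪 → ¬ W.HasGoodReductionAtPrime ℓ) → IsGrossencharakter 𝔪 (embType σK) (embTypeConj σK) ψ →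
            (∀ n : ℕ, Odd n → n.Coprime ((NumberField.discr K).natAbs * Ideal.absNorm 𝔪) → idealPow K ψ (Ideal.span {(n : 𝓞 K)}) = (jacobiSym (NumberField.discr K) n : ℂ) * (n : ℂ) ^ (2 - 1)) → (∀ (ℓ : ℕ) [Fact ℓ.Prime], ℓ ≠ p → W.HasGoodReductionAtPrime ℓ → ‖e.symm (∑ᶠ (w : HeightOneSpectrum (𝓞 K)) (_ : Ideal.absNorm w.asIdeal = ℓ), ψ w) - (W.frobeniusTrace ℓ : PadicAlgCl p)‖ < 1) →
            (∃ v : HeightOneSpectrum (𝓞 K), v.asIdeal = Ideal.span {(p : 𝓞 K)} ∧ Nat.card (𝓞 K ⧸ v.asIdeal) = p ^ 2) → ∀ (hnd : ¬ (p : ℤ) ∣ NumberField.discr K), ∀ (Φ : Multiplicative (AddAut (geomTorsion W p)) ≃* GL (Fin 2) (ZMod p)) (k : Subalgebra (ZMod p) (Matrix (Fin 2) (Fin 2) (ZMod p))) (e₀ : geomTorsion W p ≃+ (Fin 2 → ZMod p)), (∀ (g : Multiplicative (AddAut (geomTorsion W p))) (x : geomTorsion W p),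
              e₀ (Multiplicative.toAdd g x) = ((Φ g : GL (Fin 2) (ZMod p)) : Matrix (Fin 2) (Fin 2) (ZMod p)) *ᵥ e₀ x) → IsField k → Module.finrank (ZMod p) k = 2 → (letI : Module (ZMod p) (geomTorsion W p) := AddSubgroup.torsionBy.zmodModule ; ∀ g : Multiplicative (AddAut (geomTorsion W p)), Matrix.trace ((Φ g : GL (Fin 2) (ZMod p)) : Matrix (Fin 2) (Fin 2) (ZMod p)) = LinearMap.trace (ZMod p) (geomTorsion W p) ((Multiplicative.toAdd g).toAddMonoidHom.toZModLinearMap p)) →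
            (galoisRepTorsion W p).range.map Φ.toMonoidHom ≤ Subgroup.normalizer (Serre1972.unitGroup k : Set (GL (Fin 2) (ZMod p))) → ((Serre1972.unitGroup k).comap Φ.toMonoidHom).comap (galoisRepTorsion W p) ≤ (absGaloisRestrict ℚ K).toMonoidHom.range → (∀ τ : absoluteGaloisGroup K, Φ (galoisRepTorsion W p (absGaloisRestrict ℚ K τ)) ∈ Serre1972.unitGroup k) → ∀ (M : ℕ) [NeZero M] (g : CuspForm (Gamma0 M) 2) (ι : coeffField g →+* PadicAlgCl p) (Ω : ℂ),
            ¬ p ∣ M → IsNewform0 g → Literature.NumberTheory.Automorphic.IsCMForm (liftToGamma1 M 2 g) → cuspCoeff g p = 0 → IsCohomologicalPlusPeriod g ι Ω → (∀ ℓ : ℕ, ℓ.Prime → ¬ ℓ ∣ p * M * W.conductorNorm ℤ → ‖embCoeff g ι ℓ - (W.frobeniusTrace ℓ : PadicAlgCl p)‖ < 1) → (∀ ℓ : ℕ, ℓ.Prime → ¬ ℓ ∣ (NumberField.discr K).natAbs * Ideal.absNorm 𝔪 → embCoeff g ι ℓ = e.symm (∑ᶠ (w : HeightOneSpectrum (𝓞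 K)) (_ : Ideal.absNorm w.asIdeal = ℓ), ψ w)) →
            ∀ (κ : ZpExtension ℚ p) (γ : absoluteGaloisGroup ℚ), ∀ (hκ : κ.IsCyclotomic), κ.IsTopGenerator γ → IsCyclotomicVariable p γ → ∀ (S₀ : Finset (HeightOneSpectrum (𝓞 ℚ))), (∀ v ∈ S₀, ((p : ℕ) : 𝓞 ℚ) ∉ v.asIdeal) → (∀ v : HeightOneSpectrum (𝓞 ℚ), ¬ W.HasGoodReductionAt v → v ∈ S₀) → (∀ v : HeightOneSpectrum (𝓞 ℚ), natGenerator v ∣ M → v ∈ S₀) → ∀ (S : Set (PadicAlgCl p)) (θ : FramedGaloisRep K (padicCoeffIntegers S) 1) (γK : absoluteGaloisGroup K)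
              (j : (W.baseChange K).geomPrimaryTorsion p →+ (GreenbergSelmer.Cofree θ (padicCoeffField S))), ∀ (hS : 0 < Module.finrank ℚ_[p] (padicCoeffField S)), (∀ w : HeightOneSpectrum (𝓞 K), (p : 𝓞 K) ∉ w.asIdeal → ¬ 𝔪 ≤ w.asIdeal → θ.IsUnramifiedAt w ∧ ∃ P : Polynomial (padicCoeffIntegers S), P.map (padicCoeffIntegers S).subtype = X - C (e.symm (ψ w)) ∧ θ.HasFrobCharpolyAt w P) → ∀ (hγK : (κ.restrictOfFinrankEqTwo hp K hK2).IsTopGenerator γK),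
              (∀ v : HeightOneSpectrum (𝓞 K), (p : 𝓞 K) ∈ v.asIdeal → ∀ (δ : absoluteGaloisGroup (v.adicCompletion K)) (t : (W.baseChange K).geomPrimaryTorsion p), j (resGalOfEmb (closureEmb (K := K) (v.adicCompletion K)) δ • t) = resGalOfEmb (closureEmb (K := K) (v.adicCompletion K)) δ • j t) → Submodule.span (padicCoeffIntegers S) (Set.range j) = ⊤ → ∀ (Dψ : SmallImageCharSignedSelmer.SignedTransportDualDataSat (κ.restrictOfFinrankEqTwo hp K hK2) γK
                (GreenbergSelmer.Cofree θ (padicCoeffField S)) (padicCoeffIntegers S) (W.baseChange K) j {w : HeightOneSpectrum (𝓞 K) | ∃ v ∈ S₀, ((natGenerator v : ℕ) : 𝓞 K) ∈ w.asIdeal} ε), Module.Finite (IwasawaAlgebra p) Dψ.X → Module.IsTorsion (IwasawaAlgebra p) Dψ.X → ∀ L : IwasawaAlgebraO (Set.range ι), L ≠ 0 → (∀ n : ℕ, (Even n ↔ ε = 1) → IsCongrModOmegaO (Set.range ι) n ((mazurTateElementK g Ω p n).map ι)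
                (((((-1) ^ (n / 2 + 1) * (if ε = 1 then cyclotomicOmegaMinus p n else cyclotomicOmegaPlus p n)).map (Int.castRingHom (PadicAlgCl p)) : (PadicAlgCl p)[X]) : PowerSeries (PadicAlgCl p)) * iwasawaOToPowerSeries (Set.range ι) L)) → ∀ (vp : HeightOneSpectrum (𝓞 K)) (hv : vp.asIdeal = Ideal.span {((p : ℕ) : 𝓞 K)}), ∀ (κ₂ : ZpExtension K p) (γ₂ : absoluteGaloisGroup K) (𝔣 : Ideal (𝓞 K)) (χ₀ θ' : absoluteGaloisGroup K →ₜ* (↥(padicCoeffIntegers S))ˣ)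
                    (D₀ : Literature.NumberTheory.ComplexMultiplication.EllipticUnits.JohnsonLeungKings2011.TwistedIwasawaDataO S (κ.restrictOfFinrankEqTwo hp K hK2) κ₂ γK⁻¹ γ₂ χ₀ 𝔣 σK) (D₀' : Literature.NumberTheory.ComplexMultiplication.EllipticUnits.JohnsonLeungKings2011.IwasawaCohomologyDataO S (κ.restrictOfFinrankEqTwo hp K hK2) κ₂ γK⁻¹ γ₂ θ' 𝔣 0)
                    (D₁' : Literature.NumberTheory.ComplexMultiplication.EllipticUnits.JohnsonLeungKings2011.IwasawaCohomologyDataO S (κ.restrictOfFinrankEqTwo hp K hK2) κ₂ γK⁻¹ γ₂ θ' 𝔣 1) (D₂' : Literature.NumberTheory.ComplexMultiplication.EllipticUnits.JohnsonLeungKings2011.IwasawaCohomologyDataO S (κ.restrictOfFinrankEqTwo hp K hK2) κ₂ γK⁻¹ γ₂ θ' 𝔣 2) (hθfin : ∃ m : ℕ, 0 < m ∧ ∀ τ : absoluteGaloisGroup K, χ₀ τ ^ m = 1)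
                    (hker : ∀ τ ∈ ZpExtension.pairKer (κ.restrictOfFinrankEqTwo hp K hK2) κ₂, θ' τ = χ₀ τ) (hN : ∀ k : ℕ, ∀ τ ∈ ramificationSubgroup K (Literature.NumberTheory.ComplexMultiplication.EllipticUnits.JohnsonLeungKings2011.suppPF p 𝔣), ∃ b : ↥(padicCoeffIntegers S), ((θ' τ : (↥(padicCoeffIntegers S))ˣ) : ↥(padicCoeffIntegers S)) = (χ₀ τ : (↥(padicCoeffIntegers S))ˣ) + ((p : ↥(padicCoeffIntegers S))) ^ k * b)
                    (σ : Literature.NumberTheory.ComplexMultiplication.EllipticUnits.IwasawaAlgebraO₂ S ≃+* Literature.NumberTheory.ComplexMultiplication.EllipticUnits.IwasawaAlgebraO₂ S)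
                    (Dθ : Literature.NumberTheory.ComplexMultiplication.EllipticUnits.JohnsonLeungKings2011.ZetaSkeleton (Literature.NumberTheory.ComplexMultiplication.EllipticUnits.IwasawaAlgebraO₂ S) (Literature.NumberTheory.ComplexMultiplication.EllipticUnits.JohnsonLeungKings2011.AuxIdeals p 𝔣) D₀'.H D₁'.H D₂'.H) (a : Literature.NumberTheory.ComplexMultiplication.EllipticUnits.JohnsonLeungKings2011.AuxIdeals p 𝔣),

                      (γ₂ ∈ ((κ.restrictOfFinrankEqTwo hp K hK2)).kerSubgroup ∧ (∃ u₁ u₂ : ℤ_[p]ˣ, ZpExtension.IsTopGeneratorPair (((κ.restrictOfFinrankEqTwo hp K hK2)).unitTwist u₁) (κ₂.unitTwist u₂) γK⁻¹ γ₂) ∧ (∀ g : absoluteGaloisGroup K, ((θ' g : (↥(padicCoeffIntegers S))ˣ) : ↥(padicCoeffIntegers S)) * ((θ g : GL (Fin 1) ↥(padicCoeffIntegers S)) : Matrix (Fin 1) (Fin 1) ↥(padicCoeffIntegers S)) 0 0 = 1) ∧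
                        Module.Finite (Literature.NumberTheory.ComplexMultiplication.EllipticUnits.IwasawaAlgebraO₂ S) D₀.D1.H ∧ Module.Finite (Literature.NumberTheory.ComplexMultiplication.EllipticUnits.IwasawaAlgebraO₂ S) D₀.D2.H ∧ (D₀.toZetaSkeleton (D₀.nsub_regular hθfin)).Thm52Shape ∧
                        (∀ (r : Literature.NumberTheory.ComplexMultiplication.EllipticUnits.IwasawaAlgebraO₂ S) (x : D₀.D1.H), Summit.BirchSwinnertonDyer.BirchSwinnertonDyer.Theorems.SmallImageRttD2Twist.twistEquivOfKer S (κ.restrictOfFinrankEqTwo hp K hK2) κ₂ χ₀ θ' 𝔣 hker hN D₀.D1 D₁' (r • x) = σ r • Summit.BirchSwinnertonDyer.BirchSwinnertonDyer.Theorems.SmallImageRttD2Twist.twistEquivOfKer S (κ.restrictOfFinrankEqTwo hp K hK2) κ₂ χ₀ θ' 𝔣 hker hN D₀.D1 D₁' x) ∧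
                        (∀ a' : Literature.NumberTheory.ComplexMultiplication.EllipticUnits.JohnsonLeungKings2011.AuxIdeals p 𝔣, Summit.BirchSwinnertonDyer.BirchSwinnertonDyer.Theorems.SmallImageRttD2Twist.twistEquivOfKer S (κ.restrictOfFinrankEqTwo hp K hK2) κ₂ χ₀ θ' 𝔣 hker hN D₀.D1 D₁' ((D₀.toZetaSkeleton (D₀.nsub_regular hθfin)).aZeta a') = Dθ.aZeta a') ∧
                        (∀ (r : Literature.NumberTheory.ComplexMultiplication.EllipticUnits.IwasawaAlgebraO₂ S) (x : D₀.D2.H), Summit.BirchSwinnertonDyer.BirchSwinnertonDyer.Theorems.SmallImageRttD2Twist.twistEquivOfKer S (κ.restrictOfFinrankEqTwo hp K hK2) κ₂ χ₀ θ' 𝔣 hker hN D₀.D2 D₂' (r • x) = σ r • Summit.BirchSwinnertonDyer.BirchSwinnertonDyer.Theorems.SmallImageRttD2Twist.twistEquivOfKer S (κ.restrictOfFinrankEqTwo hp K hK2) κ₂ χ₀ θ' 𝔣 hker hN D₀.D2 D₂' x) ∧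
                        (∀ (r : Literature.NumberTheory.ComplexMultiplication.EllipticUnits.IwasawaAlgebraO₂ S) (x : D₀.D0.H), Summit.BirchSwinnertonDyer.BirchSwinnertonDyer.Theorems.SmallImageRttD2Twist.twistEquivOfKer S (κ.restrictOfFinrankEqTwo hp K hK2) κ₂ χ₀ θ' 𝔣 hker hN D₀.D0 D₀' (r • x) = σ r • Summit.BirchSwinnertonDyer.BirchSwinnertonDyer.Theorems.SmallImageRttD2Twist.twistEquivOfKer S (κ.restrictOfFinrankEqTwo hp K hK2) κ₂ χ₀ θ' 𝔣 hker hN D₀.D0 D₀' x) ∧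
                        (∀ a' : Literature.NumberTheory.ComplexMultiplication.EllipticUnits.JohnsonLeungKings2011.AuxIdeals p 𝔣, Dθ.nsub a' = σ ((D₀.toZetaSkeleton (D₀.nsub_regular hθfin)).nsub a')) ∧ σ PowerSeries.X = (PowerSeries.C (PowerSeries.C (((χ₀ γK⁻¹ * (θ' γK⁻¹)⁻¹ : (↥(padicCoeffIntegers S))ˣ)) : ↥(padicCoeffIntegers S)) : PowerSeries ↥(padicCoeffIntegers S)) : Literature.NumberTheory.ComplexMultiplication.EllipticUnits.IwasawaAlgebraO₂ S) * (1 + PowerSeries.X) - 1 ∧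
                        σ (PowerSeries.C (PowerSeries.X : PowerSeries ↥(padicCoeffIntegers S))) = (PowerSeries.C (PowerSeries.C (((χ₀ γ₂ * (θ' γ₂)⁻¹ : (↥(padicCoeffIntegers S))ˣ)) : ↥(padicCoeffIntegers S)) : PowerSeries ↥(padicCoeffIntegers S)) : Literature.NumberTheory.ComplexMultiplication.EllipticUnits.IwasawaAlgebraO₂ S) *
                            (1 + (PowerSeries.C (PowerSeries.X : PowerSeries ↥(padicCoeffIntegers S)) : Literature.NumberTheory.ComplexMultiplication.EllipticUnits.IwasawaAlgebraO₂ S)) - 1 ∧ (∀ c : ↥(padicCoeffIntegers S), σ (PowerSeries.C (PowerSeries.C c : PowerSeries ↥(padicCoeffIntegers S))) = PowerSeries.C (PowerSeries.C c : PowerSeries ↥(padicCoeffIntegers S))) ∧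
                        Submodule.torsionBy (Literature.NumberTheory.ComplexMultiplication.EllipticUnits.IwasawaAlgebraO₂ S) D₁'.H (PowerSeries.C (PowerSeries.X - PowerSeries.C (0 : ↥(padicCoeffIntegers S)) : PowerSeries ↥(padicCoeffIntegers S)) : Literature.NumberTheory.ComplexMultiplication.EllipticUnits.IwasawaAlgebraO₂ S) = ⊥ ∧ IsUnit (Summit.BirchSwinnertonDyer.BirchSwinnertonDyer.Theorems.SmallImageRttD2J2.phi0 S (Dθ.nsub a)))
                      →
                          ((∀ w ∈ Literature.NumberTheory.ComplexMultiplication.EllipticUnits.JohnsonLeungKings2011.suppPF p 𝔣, ((p : ℕ) : 𝓞 K) ∉ w.asIdeal → ∃ 𝔓 ∈ w.primesAbove, ∃ τ ∈ 𝔓.inertia (absoluteGaloisGroup K), θ' τ ≠ 1) ∧ (∀ w : HeightOneSpectrum (𝓞 K), w ∉ Literature.NumberTheory.ComplexMultiplication.EllipticUnits.JohnsonLeungKings2011.suppPF p 𝔣 → ∀ 𝔓 ∈ w.primesAbove, ∀ τ ∈ 𝔓.inertia (absoluteGaloisGroup K), θ' τ = 1))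
                          → (∀ τ ∈ absGaloisFixingSubgroup (Literature.NumberTheory.NumberFields.rayClassField K 𝔣), χ₀ τ = 1) → Ideal.span {((p : ℕ) : 𝓞 K)} ∣ 𝔣 → 𝔪 ∣ 𝔣 → ∀ (cK : K ≃ₐ[ℚ] K), (∀ w : HeightOneSpectrum (𝓞 K), ¬ 𝔪 ≤ w.asIdeal → ¬ 𝔪 ≤ (cK • w).asIdeal → ψ (cK • w) = (starRingEnd ℂ) (ψ w)) → cK • 𝔣 = 𝔣 →
                letI := SmallImageRttD2Seq.localAction (closureEmb (K := K) (vp.adicCompletion K)) (GreenbergSelmer.Cofree θ (padicCoeffField S)) ;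
                haveI := SmallImageRttD2Seq.smulCommClass_localAction (R := padicCoeffIntegers S) (GreenbergSelmer.Cofree θ (padicCoeffField S)) vp ;
                haveI : FiniteDimensional ℚ_[p] (padicCoeffField S) := Module.finite_of_finrank_pos hS ;
                letI : Algebra (IwasawaAlgebra p) (IwasawaAlgebraO S) := (iwasawaToIwasawaO S).toAlgebra ;
                letI : Module (IwasawaAlgebraO S) (QuotSMulTop (PowerSeries.C (PowerSeries.X - PowerSeries.C (0 : ↥(padicCoeffIntegers S)) : PowerSeries ↥(padicCoeffIntegers S)) : Literature.NumberTheory.ComplexMultiplication.EllipticUnits.IwasawaAlgebraO₂ S) D₁'.H) := Module.compHom _ (PowerSeries.map (PowerSeries.C : ↥(padicCoeffIntegers S) →+* IwasawaAlgebraO S)) ;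
                letI : Module (IwasawaAlgebra p) (QuotSMulTop (PowerSeries.C (PowerSeries.X - PowerSeries.C (0 : ↥(padicCoeffIntegers S)) : PowerSeries ↥(padicCoeffIntegers S)) : Literature.NumberTheory.ComplexMultiplication.EllipticUnits.IwasawaAlgebraO₂ S) D₁'.H) := Module.compHom _ ((PowerSeries.map (PowerSeries.C : ↥(padicCoeffIntegers S) →+* IwasawaAlgebraO S)).comp (iwasawaToIwasawaO S)) ;
                letI : Module (IwasawaAlgebra p) (Submodule.torsionBy (Literature.NumberTheory.ComplexMultiplication.EllipticUnits.IwasawaAlgebraO₂ S) D₂'.H (PowerSeries.C (PowerSeries.X - PowerSeries.C (0 : ↥(padicCoeffIntegers S)) : PowerSeries ↥(padicCoeffIntegers S)) : Literature.NumberTheory.ComplexMultiplication.EllipticUnits.IwasawaAlgebraO₂ S)) :=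
                  Module.compHom _ ((PowerSeries.map (PowerSeries.C : ↥(padicCoeffIntegers S) →+* IwasawaAlgebraO S)).comp (iwasawaToIwasawaO S)) ;
                letI : Module (IwasawaAlgebra p) (QuotSMulTop (PowerSeries.C (PowerSeries.X - PowerSeries.C (0 : ↥(padicCoeffIntegers S)) : PowerSeries ↥(padicCoeffIntegers S)) : Literature.NumberTheory.ComplexMultiplication.EllipticUnits.IwasawaAlgebraO₂ S) D₂'.H) := Module.compHom _ ((PowerSeries.map (PowerSeries.C : ↥(padicCoeffIntegers S) →+* IwasawaAlgebraO S)).comp (iwasawaToIwasawaO S)) ;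
                let lamH2f : ℕ := lambdaInvariant p (QuotSMulTop (PowerSeries.C (PowerSeries.X - PowerSeries.C (0 : ↥(padicCoeffIntegers S)) : PowerSeries ↥(padicCoeffIntegers S)) : Literature.NumberTheory.ComplexMultiplication.EllipticUnits.IwasawaAlgebraO₂ S) D₂'.H) ; ∃ (I : SmallImageRttD2J1.CycIwasawaCohomologyDataO S (κ.restrictOfFinrankEqTwo hp K hK2) γK⁻¹ θ' (Literature.NumberTheory.ComplexMultiplication.EllipticUnits.JohnsonLeungKings2011.suppPF p 𝔣) 1)
                  (s : (QuotSMulTop (PowerSeries.C (PowerSeries.X - PowerSeries.C (0 : ↥(padicCoeffIntegers S)) : PowerSeries ↥(padicCoeffIntegers S)) : Literature.NumberTheory.ComplexMultiplication.EllipticUnits.IwasawaAlgebraO₂ S) D₁'.H) →ₗ[IwasawaAlgebraO S] I.H) (B' : Submodule (IwasawaAlgebraO S) I.H) (E : IwasawaAlgebraO S)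
                  (s' : (QuotSMulTop (PowerSeries.C (PowerSeries.X - PowerSeries.C (0 : ↥(padicCoeffIntegers S)) : PowerSeries ↥(padicCoeffIntegers S)) : Literature.NumberTheory.ComplexMultiplication.EllipticUnits.IwasawaAlgebraO₂ S) D₁'.H) →ₗ[IwasawaAlgebraO S] ↥B'), (letI := I.moduleIwasawa; haveI := I.isScalarTower_moduleIwasawa ; Module.Finite (IwasawaAlgebra p) (I.H ⧸ LinearMap.range s) ∧ Module.IsTorsion (IwasawaAlgebra p) (I.H ⧸ LinearMap.range s) ∧
                   lambdaInvariant p (I.H ⧸ LinearMap.range s) ≤ lambdaInvariant p (Submodule.torsionBy (Literature.NumberTheory.ComplexMultiplication.EllipticUnits.IwasawaAlgebraO₂ S) D₂'.H (PowerSeries.C (PowerSeries.X - PowerSeries.C (0 : ↥(padicCoeffIntegers S)) : PowerSeries ↥(padicCoeffIntegers S)) : Literature.NumberTheory.ComplexMultiplication.EllipticUnits.IwasawaAlgebraO₂ S))) ∧ E ≠ 0 ∧ (∀ x, ((s' x : ↥B') : I.H) = E • s x) ∧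

                      (letI := SmallImageRttD2Seq.localAction (closureEmb (K := K) (vp.adicCompletion K)) (GreenbergSelmer.Cofree θ (padicCoeffField S)) ;
                      haveI := SmallImageRttD2Seq.smulCommClass_localAction (R := padicCoeffIntegers S) (GreenbergSelmer.Cofree θ (padicCoeffField S)) vp ;
                      letI : Algebra (IwasawaAlgebra p) (IwasawaAlgebraO S) := (iwasawaToIwasawaO S).toAlgebra ;
                      haveI : FiniteDimensional ℚ_[p] (padicCoeffField S) := Module.finite_of_finrank_pos hS ;
                      letI := I.moduleIwasawa ;
                      haveI := I.isScalarTower_moduleIwasawa ; ∀ (γv : absoluteGaloisGroup (vp.adicCompletion K)) (hγv : (κ.restrictOfFinrankEqTwo hp K hK2).IsTopGenerator (resGalOfEmb (closureEmb (K := K) (vp.adicCompletion K)) γv)) (DQ : SmallImageRttD2Seq.LocalCondDualData (κ.restrictOfFinrankEqTwo hp K hK2) (GreenbergSelmer.Cofree θ (padicCoeffField S)) ↥(padicCoeffIntegers S) (W.baseChange K) j ε vp γv)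
                        (instX : Module (IwasawaAlgebraO S) Dψ.X) (instQ : Module (IwasawaAlgebraO S) DQ.X) (hιX : ∀ (f : IwasawaAlgebra p) (x : Dψ.X), (letI := instX; iwasawaToIwasawaO S f • x) = f • x) (hιQ : ∀ (f : IwasawaAlgebra p) (x : DQ.X), (letI := instQ; iwasawaToIwasawaO S f • x) = f • x) (hCX : ∀ (a₁ : ↥(padicCoeffIntegers S)) (x : Dψ.X)
                            (s₁ : SmallImageCharSignedSelmer.signedTransportSelmerInftySat (κ.restrictOfFinrankEqTwo hp K hK2) (GreenbergSelmer.Cofree θ (padicCoeffField S)) ↥(padicCoeffIntegers S) (W.baseChange K) j {w : HeightOneSpectrum (𝓞 K) | ∃ v ∈ S₀, ((natGenerator v : ℕ) : 𝓞 K) ∈ w.asIdeal} ε), Dψ.toDual (letI := instX; (PowerSeries.C a₁ : IwasawaAlgebraO S) • x) s₁ = Dψ.toDual x ⟨GreenbergSelmer.scalarH1 _ _ a₁ s₁,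
                              SmallImageCharSignedSelmer.scalarH1_mem_signedTransportSelmerInftySat _ _ ↥(padicCoeffIntegers S) (W.baseChange K) j {w : HeightOneSpectrum (𝓞 K) | ∃ v ∈ S₀, ((natGenerator v : ℕ) : 𝓞 K) ∈ w.asIdeal} ε a₁ s₁.2⟩) (hCQ : ∀ (a₁ : ↥(padicCoeffIntegers S)) (x : DQ.X) (c : SmallImageRttD2Seq.localCondInftySat (κ.restrictOfFinrankEqTwo hp K hK2) (GreenbergSelmer.Cofree θ (padicCoeffField S)) ↥(padicCoeffIntegers S) (W.baseChange K) j ε vp),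
                          DQ.toDual (letI := instQ; (PowerSeries.C a₁ : IwasawaAlgebraO S) • x) c = DQ.toDual x (SmallImageRttD2Seq.scalarLocalSat _ _ ↥(padicCoeffIntegers S) (W.baseChange K) j ε vp a₁ c)),
                        letI := instX; letI := instQ ;
                        haveI : IsScalarTower (IwasawaAlgebra p) (IwasawaAlgebraO S) Dψ.X := SmallImageRttCharRoad.isScalarTower_iwasawaAlgebraO_of_smul_eq S (fun _ ↦ rfl) hιX ;
                        haveI : IsScalarTower (IwasawaAlgebra p) (IwasawaAlgebraO S) DQ.X := SmallImageRttCharRoad.isScalarTower_iwasawaAlgebraO_of_smul_eq S (fun _ ↦ rfl) hιQ ; ∃ (j₀ : ↥B' →ₗ[IwasawaAlgebraO S] DQ.X) (Col : DQ.X ≃ₗ[IwasawaAlgebraO S] IwasawaAlgebraO S) (c : PadicAlgCl p) (fv : HeightOneSpectrum (𝓞 ℚ) → ℤ_[p]), c ≠ 0 ∧ (∀ w ∈ S₀, fv w ≠ 0 ∧ (fv w).valuation = (frobeniusExponent p (natGenerator w : ℤ_[p])).valuation) ∧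
                          iwasawaOToPowerSeries S (Col (j₀ (s' (SmallImageRttD2Spec.zetaSp (PowerSeries.C (PowerSeries.X - PowerSeries.C (0 : ↥(padicCoeffIntegers S)) : PowerSeries ↥(padicCoeffIntegers S)) : Literature.NumberTheory.ComplexMultiplication.EllipticUnits.IwasawaAlgebraO₂ S) Dθ a)))) = PowerSeries.C c * iwasawaOToPowerSeries (Set.range ι) L * ∏ w ∈ S₀, Polynomial.aeval (PowerSeries.C ((natGenerator w : PadicAlgCl p)⁻¹) *
                                  (PowerSeries.binomialSeries ℤ_[p] (fv w)).map (algebraMap ℤ_[p] (PadicAlgCl p))) (1 - Polynomial.C (embCoeff g ι (natGenerator w)) * Polynomial.X + (if natGenerator w ∣ M then 0 else Polynomial.C (natGenerator w : PadicAlgCl p)) * (Polynomial.X : Polynomial (PadicAlgCl p)) ^ 2) ∧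
                          let gX := SmallImageRttD2Seq.gXLinearMapO S Dψ DQ (fun _ _ ↦ rfl) (SmallImageRttD2Seq.natCast_mem_asIdeal_of_eq_span hv) instX instQ hιX hιQ hCX hCQ (GreenbergSelmer.exists_pow_smul_cofree_eq_zero S θ) (GreenbergSelmer.isOpen_stabilizer_cofree S θ) (SmallImageRttD2Seq.isOpen_stabilizer_of_hres (GreenbergSelmer.Cofree θ (padicCoeffField S)) vp (fun _ _ ↦ rfl) (GreenbergSelmer.isOpen_stabilizer_cofree S θ)) hγK
                                (SmallImageRttD2Seq.isNonsplitIn_restrictOfFinrankEqTwo hp hκ K hK2 hnd (SmallImageRttD2Seq.natCast_mem_asIdeal_of_eq_span hv)) hγv; Function.Exact j₀ gX ∧ lamH2f + lambdaInvariant p (IwasawaAlgebraO S ⧸ Ideal.span {E}) ≤ lambdaInvariant p (Dψ.X ⧸ LinearMap.range gX) + lambdaInvariant p (I.H ⧸ LinearMap.range (Submodule.subtype B')))) := by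
  intro hRib hKP hKPd hKP29 hF1 hRes W _ _ p _ hp hX7 hncm hap hns hT1 hT1u ε K _ _ σK 𝔪 ψ e hK2 htc h𝔪 hnormI hcop hbad hψ hψpow hcongrW hinert hnd Φ k e₀ hΦ hkf hk2 htr hnorm hUK hUθ M _ g ι Ω hpM hng hcm hapg hΩ hcoeffW hcoeffψ κ γ hκ hγ hcv S₀ hS₀p hS₀bad hS₀M S θ γK j hS hθ hγK hj hjspan Dψ hfin htor L hL hcongr vp hv κ₂ γ₂ 𝔣 χ₀ θ' D₀ D₀' D₁' D₂' hθfin hkerχ hNχ σ Dθ a hframe hsupp hχ𝔣 hp𝔣 h𝔪𝔣 cK hψc h𝔣c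
  have hframe' := hframe
  obtain ⟨hγ₂, hγpair, hθ'θ, hfin1, hfin2, h52χ, he₁, haZ, he₂, he₀, hnsub, hσX, hσCX, hσC, hH1, ha⟩ := hframe'
  haveI : FiniteDimensional ℚ_[p] (padicCoeffField S) := Module.finite_of_finrank_pos hS
  haveI : IsTotallyComplex K := htc
  haveI : IsDiscreteValuationRing ↥(padicCoeffIntegers S) := by
    rw [padicCoeffIntegers_eq_unitBall S]; exact LambdaLowerBoundO.isDiscreteValuationRing_unitBall p _
  haveI := hfin1
  haveI := hfin2
  letI : Algebra (IwasawaAlgebra p) (IwasawaAlgebraO S) := (iwasawaToIwasawaO S).toAlgebra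
  letI := SmallImageRttD2Seq.localAction (closureEmb (K := K) (vp.adicCompletion K)) (GreenbergSelmer.Cofree θ (padicCoeffField S))
  haveI := SmallImageRttD2Seq.smulCommClass_localAction (R := padicCoeffIntegers S) (GreenbergSelmer.Cofree θ (padicCoeffField S)) vp
  letI : Module (IwasawaAlgebraO S) (QuotSMulTop (PowerSeries.C (PowerSeries.X - PowerSeries.C (0 : ↥(padicCoeffIntegers S)) : PowerSeries ↥(padicCoeffIntegers S)) : Literature.NumberTheory.ComplexMultiplication.EllipticUnits.IwasawaAlgebraO₂ S) D₁'.H) :=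
    Module.compHom _ (PowerSeries.map (PowerSeries.C : ↥(padicCoeffIntegers S) →+* IwasawaAlgebraO S))
  letI : Module (IwasawaAlgebra p) (QuotSMulTop (PowerSeries.C (PowerSeries.X - PowerSeries.C (0 : ↥(padicCoeffIntegers S)) : PowerSeries ↥(padicCoeffIntegers S)) : Literature.NumberTheory.ComplexMultiplication.EllipticUnits.IwasawaAlgebraO₂ S) D₁'.H) :=
    Module.compHom _ ((PowerSeries.map (PowerSeries.C : ↥(padicCoeffIntegers S) →+* IwasawaAlgebraO S)).comp (iwasawaToIwasawaO S))
  letI : Module (IwasawaAlgebra p) (Submodule.torsionBy (Literature.NumberTheory.ComplexMultiplication.EllipticUnits.IwasawaAlgebraO₂ S) D₂'.H (PowerSeries.C (PowerSeries.X - PowerSeries.C (0 : ↥(padicCoeffIntegers S)) : PowerSeries ↥(padicCoeffIntegers S)) : Literature.NumberTheory.ComplexMultiplication.EllipticUnits.IwasawaAlgebraO₂ S)) :=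
    Module.compHom _ ((PowerSeries.map (PowerSeries.C : ↥(padicCoeffIntegers S) →+* IwasawaAlgebraO S)).comp (iwasawaToIwasawaO S))
  letI : Module (IwasawaAlgebra p) (QuotSMulTop (PowerSeries.C (PowerSeries.X - PowerSeries.C (0 : ↥(padicCoeffIntegers S)) : PowerSeries ↥(padicCoeffIntegers S)) : Literature.NumberTheory.ComplexMultiplication.EllipticUnits.IwasawaAlgebraO₂ S) D₂'.H) :=
    Module.compHom _ ((PowerSeries.map (PowerSeries.C : ↥(padicCoeffIntegers S) →+* IwasawaAlgebraO S)).comp (iwasawaToIwasawaO S))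
  have hNP : ∀ n : ℕ, ramificationSubgroup K (Literature.NumberTheory.ComplexMultiplication.EllipticUnits.JohnsonLeungKings2011.suppPF p 𝔣) ≤ (κ.restrictOfFinrankEqTwo hp K hK2).layerSubgroup n :=
    fun n ↦ ((Summit.BirchSwinnertonDyer.BirchSwinnertonDyer.Theorems.PrintCf2.JLKDescent.ramificationSubgroup_suppPF_le_pairKer (κ.restrictOfFinrankEqTwo hp K hK2) κ₂ 𝔣).trans
      (ZpExtension.pairKer_le_left _ _)).trans (ZpExtension.kerSubgroup_le_layerSubgroup _ n)
  have hS1 := fun I' ↦ SmallImageRttJunctionLocal.exists_junctionDepletion_smul_mem_strictCarrier_ns S (κ.restrictOfFinrankEqTwo hp K hK2) hγK S₀ hS₀p 𝔣 κ₂ θ' hθfin hkerχ hsupp.1 I'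
  have hS1c :
                ∀ (T : Finset (HeightOneSpectrum (𝓞 K)))
                    (φ : HeightOneSpectrum (𝓞 K) → absoluteGaloisGroup K) (x : HeightOneSpectrum (𝓞 K) → ℤ_[p]) (d : ℕ),
                  (∀ w, w ∈ T ↔ (w ∈ {w : HeightOneSpectrum (𝓞 K) | ∃ v ∈ S₀, ((natGenerator v : ℕ) : 𝓞 K) ∈ w.asIdeal} ∧
                    w ∉ Literature.NumberTheory.ComplexMultiplication.EllipticUnits.JohnsonLeungKings2011.suppPF p 𝔣)) →
                  (∀ w ∈ T, IsArithFrobAt (𝓞 K) (φ w) (adicCompletionPrime K w)) →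
                  (∀ w ∈ T, ∀ n : ℕ, γK⁻¹ ^ (PadicInt.toZModPow n (x w)).val * (φ w)⁻¹ ∈ (κ.restrictOfFinrankEqTwo hp K hK2).layerSubgroup n) →
                  ∃ (fv : HeightOneSpectrum (𝓞 ℚ) → ℤ_[p]) (u : (IwasawaAlgebraO S)ˣ) (c' : PadicAlgCl p), c' ≠ 0 ∧
                    (∀ w ∈ S₀, fv w ≠ 0 ∧ (fv w).valuation = (frobeniusExponent p (natGenerator w : ℤ_[p])).valuation) ∧
                    iwasawaOToPowerSeries S ((u : IwasawaAlgebraO S) *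
                        (PowerSeries.C ((p : ↥(padicCoeffIntegers S)) ^ d) * ∏ w ∈ T, (iwasawaToIwasawaO S (PowerSeries.binomialSeries ℤ_[p] (x w)) - PowerSeries.C (((θ' (φ w) : (↥(padicCoeffIntegers S))ˣ) : ↥(padicCoeffIntegers S)) * padicIntToCoeffIntegers S ((GaloisRep.cyclotomicCharacter K p (φ w) : ℤ_[p]ˣ) : ℤ_[p]))))
                        ) = PowerSeries.C c' *
                            (∏ w ∈ S₀, Polynomial.aeval (PowerSeries.C ((natGenerator w : PadicAlgCl p)⁻¹) * (PowerSeries.binomialSeries ℤ_[p] (fv w)).map (algebraMap ℤ_[p] (PadicAlgCl p))) (1 - Polynomial.C (embCoeff g ι (natGenerator w)) * Polynomial.X + (if natGenerator w ∣ M then 0 else Polynomial.C (natGenerator w : PadicAlgCl p)) * (Polynomial.X : Polynomial (PadicAlgCl p)) ^ 2)) := fun T φ x d hT hφ hx ↦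
    SmallImageRttJunctionEuler.junctionEulerId_ns_of_eulerFactors hp hK2 hκ hγ hcv S θ θ' hθ'θ hγK S₀ hS₀p 𝔣 hsupp.1 hsupp.2 g ι
      (fun v hv Tv φ' dg hTv hφ' hdg ↦ hRib K hK2 htc σK 𝔪 h𝔪 ψ hψ hψpow p e M g ι hng hcoeffψ S θ hθ (natGenerator v) (prime_natGenerator v)
        (Summit.BirchSwinnertonDyer.Rank1Residual.X2.EulerFactorInvariants.natGenerator_ne_of_natCast_not_mem v (hS₀p v hv)) Tv φ' dg hTv
        (fun w hw ↦ ⟨_, adicCompletionPrime_mem_primesAbove K w, hφ' w hw⟩) hdg)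
      T φ x d hT hφ hx
  have hS2 := junctionExact_ns hKP W p hp hX7 hncm hap hns hT1 hT1u ε K σK 𝔪 ψ e hK2 htc h𝔪 hnormI hcop hbad hψ hψpow hcongrW hinert hnd Φ k e₀ hΦ hkf hk2 htr hnorm hUK hUθ M g ι Ω hpM hng hcm hapg hΩ hcoeffW hcoeffψ κ γ hκ hγ hcv S₀ hS₀p hS₀bad hS₀M S θ γK j hS hθ hγK hj hjspan Dψ hfin htor L hL hcongr vp hv κ₂ γ₂ 𝔣 χ₀ θ' D₀ D₀' D₁' D₂' hθfin hkerχ hNχ σ Dθ a hframe hsupp hθ'θ hNP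
  have hS3a : lambdaInvariant p (QuotSMulTop (PowerSeries.C (PowerSeries.X - PowerSeries.C (0 : ↥(padicCoeffIntegers S)) : PowerSeries ↥(padicCoeffIntegers S)) : Literature.NumberTheory.ComplexMultiplication.EllipticUnits.IwasawaAlgebraO₂ S) D₂'.H) ≤
      (@lambdaInvariant p _ (SmallImageRttD2Seq.strictSelmer (κ.restrictOfFinrankEqTwo hp K hK2) (GreenbergSelmer.Cofree θ (padicCoeffField S)) ↥(padicCoeffIntegers S) (W.baseChange K) j {w : HeightOneSpectrum (𝓞 K) | ∃ v ∈ S₀, ((natGenerator v : ℕ) : 𝓞 K) ∈ w.asIdeal} ε ({w : HeightOneSpectrum (𝓞 K) | ∃ v ∈ S₀, ((natGenerator v : ℕ) : 𝓞 K) ∈ w.asIdeal} ∪ {w : HeightOneSpectrum (𝓞 K) | ((p : ℕ) : 𝓞 K) ∈ w.asIdeal}) →+ AddCircle (1 : ℚ)) _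
        (SmallImageRttD2Seq.strictDualModule (κ.restrictOfFinrankEqTwo hp K hK2) ↥(padicCoeffIntegers S) (W.baseChange K) j {w : HeightOneSpectrum (𝓞 K) | ∃ v ∈ S₀, ((natGenerator v : ℕ) : 𝓞 K) ∈ w.asIdeal} ε ({w : HeightOneSpectrum (𝓞 K) | ∃ v ∈ S₀, ((natGenerator v : ℕ) : 𝓞 K) ∈ w.asIdeal} ∪ {w : HeightOneSpectrum (𝓞 K) | ((p : ℕ) : 𝓞 K) ∈ w.asIdeal}) (GreenbergSelmer.exists_pow_smul_cofree_eq_zero S θ) (GreenbergSelmer.isOpen_stabilizer_cofree S θ) hγK)) := by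
    haveI := hfin
    exact SmallImageRttJunctionSha.lambdaInvariant_quot_le_strictDual_of_rho_of_pi S (κ.restrictOfFinrankEqTwo hp K hK2) κ₂ hγK θ' 𝔣 Dψ
      ({w : HeightOneSpectrum (𝓞 K) | ∃ v ∈ S₀, ((natGenerator v : ℕ) : 𝓞 K) ∈ w.asIdeal} ∪ {w : HeightOneSpectrum (𝓞 K) | ((p : ℕ) : 𝓞 K) ∈ w.asIdeal})
      (GreenbergSelmer.exists_pow_smul_cofree_eq_zero S θ) (GreenbergSelmer.isOpen_stabilizer_cofree S θ) hγpair (SmallImageRttCharRoadJ2.ne_bot_of_auxIdeals a) D₂' htor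
      (fun I₂ b ↦ ∀ w ∈ Literature.NumberTheory.ComplexMultiplication.EllipticUnits.JohnsonLeungKings2011.suppPF p 𝔣, ∀ (n k : ℕ) (δ : absoluteGaloisGroup K),
        ContinuousCohomology.map (SmallImageRttD2Seq.locLayerHom (κ.restrictOfFinrankEqTwo hp K hK2) (Literature.NumberTheory.ComplexMultiplication.EllipticUnits.JohnsonLeungKings2011.suppPF p 𝔣) w n)
          (SmallImageRttD2Seq.locLayerMod S (κ.restrictOfFinrankEqTwo hp K hK2) θ' (Literature.NumberTheory.ComplexMultiplication.EllipticUnits.JohnsonLeungKings2011.suppPF p 𝔣) w n k) 2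
          (SmallImageRttD2J1.cycLayerConjO S (κ.restrictOfFinrankEqTwo hp K hK2) θ' (Literature.NumberTheory.ComplexMultiplication.EllipticUnits.JohnsonLeungKings2011.suppPF p 𝔣) n k 2 δ (I₂.proj n k b)) = 0)
      (fun I₂ ↦ by
        obtain ⟨m₀, hm₀pos, hχ₀m⟩ := id hθfin
        exact SmallImageRttJunctionSha.exists_rhoTwo_finite_of_frameSupp_of_goodSS hp hK2 S hκ hγ hcv θ θ' hθ'θ W hX7.1.1 hX7.1.2 j hj hjspan
          (SmallImageRttCharRoadJ2.ne_bot_of_auxIdeals a) hsupp.1 (Nat.pos_iff_ne_zero.mp hm₀pos)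
          (fun w hwp ↦ SmallImageRttJunctionLocal.apply_pow_eq_one_of_mem_inertia (κ.restrictOfFinrankEqTwo hp K hK2) κ₂ hχ₀m hkerχ hwp) vp hv hnd hNP I₂)
      (fun I₂ ↦ SmallImageRttJunctionSha.exists_pi_of_frame S (κ.restrictOfFinrankEqTwo hp K hK2) (SmallImageRttD2Seq.isCyclotomic_restrictOfFinrankEqTwo hp κ K hK2 hκ) hγK θ θ'
        hframe.2.2.1 hS 𝔣 (SmallImageRttCharRoadJ2.ne_bot_of_auxIdeals a) vp hv hNP hsupp.2 (W.baseChange K) j _ _ ε I₂)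
  have hS3b := fun (I' : SmallImageRttD2J1.CycIwasawaCohomologyDataO S (κ.restrictOfFinrankEqTwo hp K hK2) γK⁻¹ θ' (Literature.NumberTheory.ComplexMultiplication.EllipticUnits.JohnsonLeungKings2011.suppPF p 𝔣) 1) (T' : Finset (HeightOneSpectrum (𝓞 K)))
      (φ' : HeightOneSpectrum (𝓞 K) → absoluteGaloisGroup K) (x' : HeightOneSpectrum (𝓞 K) → ℤ_[p]) (d' : ℕ) hT' hφ' hx' ↦
    SmallImageRttD2Seq.lambdaInvariant_quotient_junctionDepletion_le_of_generators hp hκ hγ hcv hK2 hnd S hS θ W j ε hγK S₀ hS₀p hS₀bad hbad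
      (fun w hw h𝔪 ↦ (hθ w hw h𝔪).1) Dψ hfin htor vp hv (SmallImageRttCharRoadJ2.ne_bot_of_auxIdeals a) hθ'θ hsupp.1 hsupp.2 I' T' φ' x' d' hT'
      (SmallImageRttD2Seq.exists_unramified_generators_of_frame hp hK2 S hS hγK S₀ vp hv hsupp.2 T' φ' x' hT' hφ' hx')
  have hS4MT := junctionRecipMT_ns hKP hKPd hKP29 hF1 hRes W p hp hX7 hncm hap hns hT1 hT1u ε K σK 𝔪 ψ e hK2 htc h𝔪 hnormI hcop hbad hψ hψpow hcongrW hinert hnd Φ k e₀ hΦ hkf hk2 htr hnorm hUK hUθ M g ι Ω hpM hng hcm hapg hΩ hcoeffW hcoeffψ κ γ hκ hγ hcv S₀ hS₀p hS₀bad hS₀M S θ γK j hS hθ hγK hj hjspan Dψ hfin htor L hL hcongr vp hv κ₂ γ₂ 𝔣 χ₀ θ' D₀ D₀' D₁' D₂' hθfin hkerχ hNχ σ Dθ a hframe hsupp hχ𝔣 hp𝔣 h𝔪𝔣 cK hψc h𝔣c hθ'θ hNP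
  haveI : FiniteDimensional ℚ (coeffField g) := IsNewform0.finiteDimensional_coeffField_holds hng
  have hS4 : ∀ (I : SmallImageRttD2J1.CycIwasawaCohomologyDataO S (κ.restrictOfFinrankEqTwo hp K hK2) γK⁻¹ θ' (Literature.NumberTheory.ComplexMultiplication.EllipticUnits.JohnsonLeungKings2011.suppPF p 𝔣) 1),

          (letI := SmallImageRttD2Seq.localAction (closureEmb (K := K) (vp.adicCompletion K)) (GreenbergSelmer.Cofree θ (padicCoeffField S)) ;
          haveI := SmallImageRttD2Seq.smulCommClass_localAction (R := padicCoeffIntegers S) (GreenbergSelmer.Cofree θ (padicCoeffField S)) vp ;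
          letI : Algebra (IwasawaAlgebra p) (IwasawaAlgebraO S) := (iwasawaToIwasawaO S).toAlgebra ;
          haveI : FiniteDimensional ℚ_[p] (padicCoeffField S) := Module.finite_of_finrank_pos hS ;
          letI := I.moduleIwasawa ;
          haveI := I.isScalarTower_moduleIwasawa ;
          letI : Module (IwasawaAlgebraO S) (QuotSMulTop (PowerSeries.C (PowerSeries.X - PowerSeries.C (0 : ↥(padicCoeffIntegers S)) : PowerSeries ↥(padicCoeffIntegers S)) : Literature.NumberTheory.ComplexMultiplication.EllipticUnits.IwasawaAlgebraO₂ S) D₁'.H) := Module.compHom _ (PowerSeries.map (PowerSeries.C : ↥(padicCoeffIntegers S) →+* IwasawaAlgebraO S)) ;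
          ∀ (s : QuotSMulTop (PowerSeries.C (PowerSeries.X - PowerSeries.C (0 : ↥(padicCoeffIntegers S)) : PowerSeries ↥(padicCoeffIntegers S)) : Literature.NumberTheory.ComplexMultiplication.EllipticUnits.IwasawaAlgebraO₂ S) D₁'.H →ₗ[IwasawaAlgebraO S] I.H), (∀ (n k : ℕ) (y : D₁'.H), I.proj n k (s (Submodule.Quotient.mk y)) = SmallImageRttD2J2.spLevel S (κ.restrictOfFinrankEqTwo hp K hK2) κ₂ θ' 𝔣 n k 1 (D₁'.proj n k y)) →
          ∀ (lam : ↥(padicCoeffIntegers S) →+ ℤ_[p]) (hlam : ∀ (c : ℤ_[p]) (y : ↥(padicCoeffIntegers S)), lam (padicIntToCoeffIntegers S c * y) = c * lam y), (∀ (m : ℕ) (t : ↥(padicCoeffIntegers S)), (∀ b : ↥(padicCoeffIntegers S), SmallImageRttD2Seq.lamZMod S lam m (b * t) = 0) → t ∈ Ideal.span {((p : ℕ) : ↥(padicCoeffIntegers S)) ^ m}) →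
            (∀ (m : ℕ) (g : ↥(padicCoeffIntegers S) →+ ZMod (p ^ m)), ∃ t : ↥(padicCoeffIntegers S), ∀ b : ↥(padicCoeffIntegers S), g b = SmallImageRttD2Seq.lamZMod S lam m (b * t)) → ∀ (γv : absoluteGaloisGroup (vp.adicCompletion K)) (hγv : (κ.restrictOfFinrankEqTwo hp K hK2).IsTopGenerator (resGalOfEmb (closureEmb (K := K) (vp.adicCompletion K)) γv))
            (DQ : SmallImageRttD2Seq.LocalCondDualData (κ.restrictOfFinrankEqTwo hp K hK2) (GreenbergSelmer.Cofree θ (padicCoeffField S)) ↥(padicCoeffIntegers S) (W.baseChange K) j ε vp γv) (instQ : Module (IwasawaAlgebraO S) DQ.X) (hιQ : ∀ (f : IwasawaAlgebra p) (x : DQ.X), (letI := instQ; iwasawaToIwasawaO S f • x) = f • x)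
            (hCQ : ∀ (a₁ : ↥(padicCoeffIntegers S)) (x : DQ.X) (c : SmallImageRttD2Seq.localCondInftySat (κ.restrictOfFinrankEqTwo hp K hK2) (GreenbergSelmer.Cofree θ (padicCoeffField S)) ↥(padicCoeffIntegers S) (W.baseChange K) j ε vp), DQ.toDual (letI := instQ; (PowerSeries.C a₁ : IwasawaAlgebraO S) • x) c = DQ.toDual x (SmallImageRttD2Seq.scalarLocalSat _ _ ↥(padicCoeffIntegers S) (W.baseChange K) j ε vp a₁ c))
            (hγB : γK⁻¹ * resGalOfEmb (closureEmb (K := K) (vp.adicCompletion K)) γv ∈ (κ.restrictOfFinrankEqTwo hp K hK2).kerSubgroup),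
            letI := instQ ; ∀ jv : I.H →ₗ[IwasawaAlgebraO S] DQ.X, (∀ b : I.H, DQ.toDual (jv b) = ((SmallImageRttD2Seq.layerPairingOf S (κ.restrictOfFinrankEqTwo hp K hK2) θ' (Literature.NumberTheory.ComplexMultiplication.EllipticUnits.JohnsonLeungKings2011.suppPF p 𝔣) vp (GreenbergSelmer.Cofree θ (padicCoeffField S)) (SmallImageRttD2Seq.isOpen_stabilizer_of_hres (GreenbergSelmer.Cofree θ (padicCoeffField S)) vp (fun _ _ ↦ rfl) (GreenbergSelmer.isOpen_stabilizer_cofree S θ))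
                    (SmallImageRttD2Seq.cofreeLamCoeffPairing S lam hlam θ' (Literature.NumberTheory.ComplexMultiplication.EllipticUnits.JohnsonLeungKings2011.suppPF p 𝔣) vp θ (fun _ _ ↦ rfl) (SmallImageRttD2Seq.isOpen_stabilizer_of_hres (GreenbergSelmer.Cofree θ (padicCoeffField S)) vp (fun _ _ ↦ rfl) (GreenbergSelmer.isOpen_stabilizer_cofree S θ)) hθ'θ) (GreenbergSelmer.exists_pow_smul_cofree_eq_zero S θ) γK⁻¹ γv hγB hNP
                    (SmallImageRttD2Seq.isNonsplitIn_restrictOfFinrankEqTwo hp hκ K hK2 hnd (SmallImageRttD2Seq.natCast_mem_asIdeal_of_eq_span hv)) (SmallImageRttD2Seq.cofreeLamCoeffPairing_hPred S lam hlam θ' (Literature.NumberTheory.ComplexMultiplication.EllipticUnits.JohnsonLeungKings2011.suppPF p 𝔣) vp θ (fun _ _ ↦ rfl)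
                      (SmallImageRttD2Seq.isOpen_stabilizer_of_hres (GreenbergSelmer.Cofree θ (padicCoeffField S)) vp (fun _ _ ↦ rfl) (GreenbergSelmer.isOpen_stabilizer_cofree S θ)) hθ'θ) (SmallImageRttD2Seq.cofreeLamCoeffPairing_hPsc S lam hlam θ' (Literature.NumberTheory.ComplexMultiplication.EllipticUnits.JohnsonLeungKings2011.suppPF p 𝔣) vp θ (fun _ _ ↦ rfl)
                      (SmallImageRttD2Seq.isOpen_stabilizer_of_hres (GreenbergSelmer.Cofree θ (padicCoeffField S)) vp (fun _ _ ↦ rfl) (GreenbergSelmer.isOpen_stabilizer_cofree S θ)) hθ'θ)).towerPairing I).pairing (SmallImageRttD2Seq.isOpen_stabilizer_of_hres (GreenbergSelmer.Cofree θ (padicCoeffField S)) vp (fun _ _ ↦ rfl) (GreenbergSelmer.isOpen_stabilizer_cofree S θ)) b) → ∃ (Col : DQ.X ≃ₗ[IwasawaAlgebraO S] IwasawaAlgebraO S) (c : PadicAlgCl p), c ≠ 0 ∧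
                iwasawaOToPowerSeries S (Col (jv (s (SmallImageRttD2Spec.zetaSp (PowerSeries.C (PowerSeries.X - PowerSeries.C (0 : ↥(padicCoeffIntegers S)) : PowerSeries ↥(padicCoeffIntegers S)) : Literature.NumberTheory.ComplexMultiplication.EllipticUnits.IwasawaAlgebraO₂ S) Dθ a)))) = PowerSeries.C c * iwasawaOToPowerSeries (Set.range ι) L) := by
    intro I s₀ hs₀ lam₀ hlam₀ hInj₀ hSurj₀ γv₀ hγv₀ DQ₀ instQ₀ hιQ₀ hCQ₀ hγB₀ jv₀ hjv₀
    have h := hS4MT I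
    obtain ⟨Col₀, T, hT, cM, dM, hcM, hdM, hMT⟩ := h s₀ hs₀ lam₀ hlam₀ hInj₀ hSurj₀ γv₀ hγv₀ DQ₀ instQ₀ hιQ₀ hCQ₀ hγB₀ jv₀ hjv₀
    haveI : FiniteDimensional ℚ_[p] (padicCoeffField (S ∪ (Set.range ι ∪ T))) :=
      Summit.BirchSwinnertonDyer.BirchSwinnertonDyer.Theorems.SmallImageRttReciprocity.finiteDimensional_padicCoeffField_union_range_union S ι T hT
    have hsub : Set.range ι ⊆ Set.range ι ∪ T := Set.subset_union_left
    have hcongr' : ∀ n : ℕ, (Even n ↔ ε = 1) → IsCongrModOmegaO (Set.range ι ∪ T) n ((mazurTateElementK g Ω p n).map ι)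
        (((((-1) ^ (n / 2 + 1) * (if ε = 1 then cyclotomicOmegaMinus p n else cyclotomicOmegaPlus p n)).map (Int.castRingHom (PadicAlgCl p)) :
            (PadicAlgCl p)[X]) : PowerSeries (PadicAlgCl p)) *
          iwasawaOToPowerSeries (Set.range ι ∪ T) ((PowerSeries.map (Subring.inclusion (ThetaTransport.MazurTateValuesRelay.padicCoeffIntegers_mono hsub))) L)) :=
      fun n hn ↦ by
        rw [ThetaTransport.MazurTateValuesRelay.iwasawaOToPowerSeries_inclΛ hsub]
        exact ThetaTransport.MazurTateValuesRelay.IsCongrModOmegaO.of_subset hsub (hcongr n hn)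
    refine ⟨Col₀, (dM : PadicAlgCl p) / (cM : PadicAlgCl p), div_ne_zero ?_ ?_, ?_⟩
    · exact fun h0 ↦ hdM (Subtype.ext (by simpa using h0))
    · exact fun h0 ↦ hcM (Subtype.ext (by simpa using h0))
    · have hrel := Summit.BirchSwinnertonDyer.BirchSwinnertonDyer.Theorems.SmallImageRttReciprocity.iwasawaO_eq_C_mul_of_congruences S (Set.range ι ∪ T) ε
        (fun n ↦ (mazurTateElementK g Ω p n).map ι) _ _ cM dM hcM hMT hcongr'
      rwa [ThetaTransport.MazurTateValuesRelay.iwasawaOToPowerSeries_inclΛ hsub] at hrel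
  obtain ⟨I⟩ := SmallImageRttD2J1.nonempty_cycIwasawaCohomologyDataO (S := S) (κ := (κ.restrictOfFinrankEqTwo hp K hK2)) (γ := γK⁻¹) (θ := θ')
    (P := Literature.NumberTheory.ComplexMultiplication.EllipticUnits.JohnsonLeungKings2011.suppPF p 𝔣) (i := 1) (by norm_num)
  letI := I.moduleIwasawa
  haveI := I.isScalarTower_moduleIwasawa
  obtain ⟨res, hres⟩ := SmallImageRttD2J2.exists_coresHom (S := S) D₁' I
  obtain ⟨s, hs⟩ := SmallImageRttD2J2.exists_specialisationLinearMap_frame_zero (D₂ := D₁') (D₁ := I) hres hγ₂ (fun _ _ ↦ rfl)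
  have hspin : ∀ (n k : ℕ) (y : D₁'.H), I.proj n k (s (Submodule.Quotient.mk y)) = SmallImageRttD2J2.spLevel S (κ.restrictOfFinrankEqTwo hp K hK2) κ₂ θ' 𝔣 n k 1 (D₁'.proj n k y) :=
    fun n k y ↦ by rw [hs, hres]
  obtain ⟨T, φ, x, d, hT, hφ, hx, hkill⟩ := hS1 I
  obtain ⟨fv, u, c', hc', hfv, hEuler⟩ := hS1c T φ x d hT hφ hx
  have hP0 : ∀ w ∈ S₀, (1 - Polynomial.C (embCoeff g ι (natGenerator w)) * Polynomial.X +
      (if natGenerator w ∣ M then 0 else Polynomial.C (natGenerator w : PadicAlgCl p)) * (Polynomial.X : Polynomial (PadicAlgCl p)) ^ 2) ≠ 0 :=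
    fun w _ h0 ↦ by
      have h1 := congrArg (fun P : Polynomial (PadicAlgCl p) ↦ P.coeff 0) h0
      simp only [Polynomial.coeff_add, Polynomial.coeff_sub, Polynomial.coeff_one_zero, Polynomial.coeff_C_mul,
        Polynomial.coeff_X_zero, mul_zero, sub_zero, Polynomial.coeff_zero] at h1
      split_ifs at h1 with hd
      · simp only [zero_mul, Polynomial.coeff_zero, add_zero, one_ne_zero] at h1
      · simp only [Polynomial.coeff_C_mul, Polynomial.coeff_X_pow, mul_ite, mul_one, mul_zero] at h1
        norm_num at h1
  have hu0 : ∀ w ∈ S₀, ((natGenerator w : PadicAlgCl p))⁻¹ ≠ 0 := fun w _ ↦ SmallImageRttE2Num.inv_natCast_natGenerator_ne_zero w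
  have hf0 : ∀ w ∈ S₀, fv w ≠ 0 := fun w hw ↦ (hfv w hw).1
  have huE : (u : IwasawaAlgebraO S) *
      (PowerSeries.C ((p : ↥(padicCoeffIntegers S)) ^ d) * ∏ w ∈ T, (iwasawaToIwasawaO S (PowerSeries.binomialSeries ℤ_[p] (x w)) - PowerSeries.C (((θ' (φ w) : (↥(padicCoeffIntegers S))ˣ) : ↥(padicCoeffIntegers S)) * padicIntToCoeffIntegers S ((GaloisRep.cyclotomicCharacter K p (φ w) : ℤ_[p]ˣ) : ℤ_[p])))) ≠ 0 := by
    refine SmallImageRttCharRoad.ne_zero_of_eulerProduct (S := S) S₀ hc' (L := (1 : PowerSeries (PadicAlgCl p))) one_ne_zero (d := 0)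
      (fun k ↦ ?_) (fun k hk ↦ absurd hk (Nat.not_lt_zero k)) _ _ _ hP0 hu0 hf0 (a := (u : IwasawaAlgebraO S) *
          (PowerSeries.C ((p : ↥(padicCoeffIntegers S)) ^ d) * ∏ w ∈ T, (iwasawaToIwasawaO S (PowerSeries.binomialSeries ℤ_[p] (x w)) - PowerSeries.C (((θ' (φ w) : (↥(padicCoeffIntegers S))ˣ) : ↥(padicCoeffIntegers S)) * padicIntToCoeffIntegers S ((GaloisRep.cyclotomicCharacter K p (φ w) : ℤ_[p]ˣ) : ℤ_[p])))))
      (by rw [hEuler, mul_one])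
    rcases Nat.eq_zero_or_pos k with rfl | hk
    · exact le_rfl
    · rw [PowerSeries.coeff_one, if_neg hk.ne', norm_zero]; exact norm_nonneg _
  have hE :
      (PowerSeries.C ((p : ↥(padicCoeffIntegers S)) ^ d) * ∏ w ∈ T, (iwasawaToIwasawaO S (PowerSeries.binomialSeries ℤ_[p] (x w)) - PowerSeries.C (((θ' (φ w) : (↥(padicCoeffIntegers S))ˣ) : ↥(padicCoeffIntegers S)) * padicIntToCoeffIntegers S ((GaloisRep.cyclotomicCharacter K p (φ w) : ℤ_[p]ˣ) : ℤ_[p])))) ≠ 0 := fun h ↦ huE (by rw [h, mul_zero])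
  obtain ⟨B', hB'⟩ : ∃ B' : Submodule (IwasawaAlgebraO S) I.H, B' =
      (SmallImageRttD2Seq.strictCarrier I (SmallImageRttD2Seq.strictLevel S (κ.restrictOfFinrankEqTwo hp K hK2) θ' (Literature.NumberTheory.ComplexMultiplication.EllipticUnits.JohnsonLeungKings2011.suppPF p 𝔣) {w : HeightOneSpectrum (𝓞 K) | ∃ v ∈ S₀, ((natGenerator v : ℕ) : 𝓞 K) ∈ w.asIdeal})
        (fun n k f _ hy ↦ SmallImageRttD2Seq.smul_mem_strictLevel S (κ.restrictOfFinrankEqTwo hp K hK2) θ' (Literature.NumberTheory.ComplexMultiplication.EllipticUnits.JohnsonLeungKings2011.suppPF p 𝔣) {w : HeightOneSpectrum (𝓞 K) | ∃ v ∈ S₀, ((natGenerator v : ℕ) : 𝓞 K) ∈ w.asIdeal} γK⁻¹ n k f hy)) := ⟨_, rfl⟩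
  have hkill' : ∀ y, (
      (PowerSeries.C ((p : ↥(padicCoeffIntegers S)) ^ d) * ∏ w ∈ T, (iwasawaToIwasawaO S (PowerSeries.binomialSeries ℤ_[p] (x w)) - PowerSeries.C (((θ' (φ w) : (↥(padicCoeffIntegers S))ˣ) : ↥(padicCoeffIntegers S)) * padicIntToCoeffIntegers S ((GaloisRep.cyclotomicCharacter K p (φ w) : ℤ_[p]ˣ) : ℤ_[p]))))
      • s) y ∈ B' := fun y ↦ by rw [hB', LinearMap.smul_apply]; exact hkill (s y)
  let s' : QuotSMulTop (PowerSeries.C (PowerSeries.X - PowerSeries.C (0 : ↥(padicCoeffIntegers S)) : PowerSeries ↥(padicCoeffIntegers S)) : Literature.NumberTheory.ComplexMultiplication.EllipticUnits.IwasawaAlgebraO₂ S) D₁'.H →ₗ[IwasawaAlgebraO S] ↥B' :=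
    LinearMap.codRestrict B' (
        (PowerSeries.C ((p : ↥(padicCoeffIntegers S)) ^ d) * ∏ w ∈ T, (iwasawaToIwasawaO S (PowerSeries.binomialSeries ℤ_[p] (x w)) - PowerSeries.C (((θ' (φ w) : (↥(padicCoeffIntegers S))ˣ) : ↥(padicCoeffIntegers S)) * padicIntToCoeffIntegers S ((GaloisRep.cyclotomicCharacter K p (φ w) : ℤ_[p]ˣ) : ℤ_[p])))) • s) hkill'
  have hs' : ∀ y, ((s' y : ↥B') : I.H) =
      (PowerSeries.C ((p : ↥(padicCoeffIntegers S)) ^ d) * ∏ w ∈ T, (iwasawaToIwasawaO S (PowerSeries.binomialSeries ℤ_[p] (x w)) - PowerSeries.C (((θ' (φ w) : (↥(padicCoeffIntegers S))ˣ) : ↥(padicCoeffIntegers S)) * padicIntToCoeffIntegers S ((GaloisRep.cyclotomicCharacter K p (φ w) : ℤ_[p]ˣ) : ℤ_[p])))) • s y := fun _ ↦ rfl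
  obtain ⟨lam, hlam, hInj, hSurj⟩ := SmallImageRttD2Seq.exists_lam_perfect S
  have hvp := SmallImageRttD2Seq.natCast_mem_asIdeal_of_eq_span hv
  have hnon := SmallImageRttD2Seq.isNonsplitIn_restrictOfFinrankEqTwo hp hκ K hK2 hnd hvp
  have htorC := GreenbergSelmer.exists_pow_smul_cofree_eq_zero S θ
  have hstabK := GreenbergSelmer.isOpen_stabilizer_cofree S θ
  have hstab := SmallImageRttD2Seq.isOpen_stabilizer_of_hres (GreenbergSelmer.Cofree θ (padicCoeffField S)) vp (fun _ _ ↦ rfl) hstabK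
  have hγBof : ∀ (γv : absoluteGaloisGroup (vp.adicCompletion K)),
      (κ.restrictOfFinrankEqTwo hp K hK2).IsTopGenerator (resGalOfEmb (closureEmb (K := K) (vp.adicCompletion K)) γv) →
      γK⁻¹ * resGalOfEmb (closureEmb (K := K) (vp.adicCompletion K)) γv ∈ (κ.restrictOfFinrankEqTwo hp K hK2).kerSubgroup := fun γv hγv ↦ by
    rw [ZpExtension.mem_kerSubgroup, map_mul, map_inv]
    unfold ZpExtension.IsTopGenerator at hγK hγv
    rw [hγK, hγv, inv_mul_cancel]
  obtain ⟨γv₀, hγv₀⟩ := SmallImageRttD2Seq.exists_localGenerator_restrictOfFinrankEqTwo hp hκ K hK2 hnd hvp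
  obtain ⟨DQ₀⟩ := SmallImageRttD2Seq.nonempty_localCondDualData_cofree' (V := W.baseChange K) (j := j) (ε := ε) (fun _ _ ↦ rfl) hnon hγv₀
  obtain ⟨instQ₀, hιQ₀, hCQ₀⟩ := DQ₀.exists_moduleO htorC hstab hnon hγv₀
  have hγB₀ := hγBof γv₀ hγv₀
  have h4₀ := hS4 I
  letI := instQ₀
  obtain ⟨jv₀, hjv₀, -⟩ := SmallImageRttD2Seq.existsUnique_junctionMap S DQ₀
    (SmallImageRttD2Seq.layerPairingOf S (κ.restrictOfFinrankEqTwo hp K hK2) θ' (Literature.NumberTheory.ComplexMultiplication.EllipticUnits.JohnsonLeungKings2011.suppPF p 𝔣) vp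
      (GreenbergSelmer.Cofree θ (padicCoeffField S)) hstab
      (SmallImageRttD2Seq.cofreeLamCoeffPairing S lam hlam θ' (Literature.NumberTheory.ComplexMultiplication.EllipticUnits.JohnsonLeungKings2011.suppPF p 𝔣) vp θ (fun _ _ ↦ rfl) hstab hθ'θ)
      htorC γK⁻¹ γv₀ hγB₀ hNP hnon
      (SmallImageRttD2Seq.cofreeLamCoeffPairing_hPred S lam hlam θ' (Literature.NumberTheory.ComplexMultiplication.EllipticUnits.JohnsonLeungKings2011.suppPF p 𝔣) vp θ (fun _ _ ↦ rfl) hstab hθ'θ)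
      (SmallImageRttD2Seq.cofreeLamCoeffPairing_hPsc S lam hlam θ' (Literature.NumberTheory.ComplexMultiplication.EllipticUnits.JohnsonLeungKings2011.suppPF p 𝔣) vp θ (fun _ _ ↦ rfl) hstab hθ'θ))
    I hstab instQ₀ hιQ₀ hCQ₀ htorC hnon hγv₀
  obtain ⟨Col₀, c₀, hc₀, hrec₀⟩ := h4₀ s hspin lam hlam hInj hSurj γv₀ hγv₀ DQ₀ instQ₀ hιQ₀ hCQ₀ hγB₀ jv₀ hjv₀
  haveI : NoZeroSMulDivisors (IwasawaAlgebraO S) DQ₀.X := by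
    refine ⟨fun {c x} h ↦ ?_⟩
    have h' : c * Col₀ x = 0 := by rw [← smul_eq_mul, ← map_smul, h, map_zero]
    exact (mul_eq_zero.mp h').imp_right fun hx ↦ Col₀.injective (by rw [hx, map_zero])
  haveI : FiniteDimensional ℚ (coeffField g) := IsNewform0.finiteDimensional_coeffField_holds hng
  haveI : FiniteDimensional ℚ_[p] (padicCoeffField (Set.range ι)) := GreenbergSelmer.finiteDimensional_padicCoeffField ι
  have hL' : iwasawaOToPowerSeries (Set.range ι) L ≠ 0 := (map_ne_zero_iff _ (iwasawaOToPowerSeries_injective _)).mpr hL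
  have hz₀ : (jv₀ ∘ₗ s) (SmallImageRttD2Spec.zetaSp (PowerSeries.C (PowerSeries.X - PowerSeries.C (0 : ↥(padicCoeffIntegers S)) : PowerSeries ↥(padicCoeffIntegers S)) : Literature.NumberTheory.ComplexMultiplication.EllipticUnits.IwasawaAlgebraO₂ S) Dθ a) ≠ 0 := by
    intro h0
    have h1 : iwasawaOToPowerSeries S (Col₀ (jv₀ (s (SmallImageRttD2Spec.zetaSp (PowerSeries.C (PowerSeries.X - PowerSeries.C (0 : ↥(padicCoeffIntegers S)) : PowerSeries ↥(padicCoeffIntegers S)) : Literature.NumberTheory.ComplexMultiplication.EllipticUnits.IwasawaAlgebraO₂ S) Dθ a)))) = 0 := by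
      rw [LinearMap.comp_apply] at h0
      rw [h0, map_zero, map_zero]
    rw [hrec₀] at h1
    exact mul_ne_zero ((map_ne_zero_iff _ (PowerSeries.C_injective)).mpr hc₀) hL' h1
  obtain ⟨s₂, hs₂pin, hfinB, htB, hcoker⟩ := SmallImageRttCharRoadJ2.junction_J2_of_ne_zero S (κ.restrictOfFinrankEqTwo hp K hK2) κ₂ θ' 𝔣 hγpair
    (SmallImageRttCharRoadJ2.ne_bot_of_auxIdeals a) D₀' D₁' D₂' I (D₀.toZetaSkeleton (D₀.nsub_regular hθfin)) h52χ σ Dθ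
    (Summit.BirchSwinnertonDyer.BirchSwinnertonDyer.Theorems.SmallImageRttD2Twist.twistEquivOfKer S (κ.restrictOfFinrankEqTwo hp K hK2) κ₂ χ₀ θ' 𝔣 hkerχ hNχ D₀.D0 D₀') (Summit.BirchSwinnertonDyer.BirchSwinnertonDyer.Theorems.SmallImageRttD2Twist.twistEquivOfKer S (κ.restrictOfFinrankEqTwo hp K hK2) κ₂ χ₀ θ' 𝔣 hkerχ hNχ D₀.D1 D₁') he₁ haZ (Summit.BirchSwinnertonDyer.BirchSwinnertonDyer.Theorems.SmallImageRttD2Twist.twistEquivOfKer S (κ.restrictOfFinrankEqTwo hp K hK2) κ₂ χ₀ θ' 𝔣 hkerχ hNχ D₀.D2 D₂') he₂ hH1 a ha (fun _ _ ↦ rfl) (fun _ _ ↦ rfl) (jv₀ ∘ₗ s) hz₀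
  have hss : s₂ = s := by
    apply LinearMap.ext
    intro y
    obtain ⟨y, rfl⟩ := Submodule.Quotient.mk_surjective _ y
    refine sub_eq_zero.mp (I.proj_injective _ fun n k ↦ ?_)
    rw [map_sub, hs₂pin, hspin, sub_self]
  rw [hss] at hfinB htB hcoker
  refine ⟨I, s, B',
      (PowerSeries.C ((p : ↥(padicCoeffIntegers S)) ^ d) * ∏ w ∈ T, (iwasawaToIwasawaO S (PowerSeries.binomialSeries ℤ_[p] (x w)) - PowerSeries.C (((θ' (φ w) : (↥(padicCoeffIntegers S))ˣ) : ↥(padicCoeffIntegers S)) * padicIntToCoeffIntegers S ((GaloisRep.cyclotomicCharacter K p (φ w) : ℤ_[p]ˣ) : ℤ_[p])))), s', ⟨hfinB, htB, hcoker⟩, hE, hs', ?_⟩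
  intro γv hγv DQ instX instQ hιX hιQ hCX hCQ
  have hγB := hγBof γv hγv
  letI := instX; letI := instQ
  obtain ⟨jv, hjv, -⟩ := SmallImageRttD2Seq.existsUnique_junctionMap S DQ
    (SmallImageRttD2Seq.layerPairingOf S (κ.restrictOfFinrankEqTwo hp K hK2) θ' (Literature.NumberTheory.ComplexMultiplication.EllipticUnits.JohnsonLeungKings2011.suppPF p 𝔣) vp
      (GreenbergSelmer.Cofree θ (padicCoeffField S)) hstab
      (SmallImageRttD2Seq.cofreeLamCoeffPairing S lam hlam θ' (Literature.NumberTheory.ComplexMultiplication.EllipticUnits.JohnsonLeungKings2011.suppPF p 𝔣) vp θ (fun _ _ ↦ rfl) hstab hθ'θ)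
      htorC γK⁻¹ γv hγB hNP hnon
      (SmallImageRttD2Seq.cofreeLamCoeffPairing_hPred S lam hlam θ' (Literature.NumberTheory.ComplexMultiplication.EllipticUnits.JohnsonLeungKings2011.suppPF p 𝔣) vp θ (fun _ _ ↦ rfl) hstab hθ'θ)
      (SmallImageRttD2Seq.cofreeLamCoeffPairing_hPsc S lam hlam θ' (Literature.NumberTheory.ComplexMultiplication.EllipticUnits.JohnsonLeungKings2011.suppPF p 𝔣) vp θ (fun _ _ ↦ rfl) hstab hθ'θ))
    I hstab instQ hιQ hCQ htorC hnon hγv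
  have h2 := hS2 I
  have hexact := h2 lam hlam hInj hSurj γv hγv DQ instX instQ hιX hιQ hCX hCQ hγB jv hjv
  have h4 := hS4 I
  obtain ⟨Col, c, hc, hrec⟩ := h4 s hspin lam hlam hInj hSurj γv hγv DQ instQ hιQ hCQ hγB jv hjv
  have h3b :
      (letI := SmallImageRttD2Seq.localAction (closureEmb (K := K) (vp.adicCompletion K)) (GreenbergSelmer.Cofree θ (padicCoeffField S)) ;
      haveI := SmallImageRttD2Seq.smulCommClass_localAction (R := padicCoeffIntegers S) (GreenbergSelmer.Cofree θ (padicCoeffField S)) vp ;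
      letI : Algebra (IwasawaAlgebra p) (IwasawaAlgebraO S) := (iwasawaToIwasawaO S).toAlgebra ;
      haveI : FiniteDimensional ℚ_[p] (padicCoeffField S) := Module.finite_of_finrank_pos hS ;
      letI := I.moduleIwasawa ;
      haveI := I.isScalarTower_moduleIwasawa ; ∀ (γv : absoluteGaloisGroup (vp.adicCompletion K)) (hγv : (κ.restrictOfFinrankEqTwo hp K hK2).IsTopGenerator (resGalOfEmb (closureEmb (K := K) (vp.adicCompletion K)) γv)) (DQ : SmallImageRttD2Seq.LocalCondDualData (κ.restrictOfFinrankEqTwo hp K hK2) (GreenbergSelmer.Cofree θ (padicCoeffField S)) ↥(padicCoeffIntegers S) (W.baseChange K) j ε vp γv) (instX : Module (IwasawaAlgebraO S) Dψ.X) (instQ : Module (IwasawaAlgebraO S) DQ.X)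
        (hιX : ∀ (f : IwasawaAlgebra p) (x : Dψ.X), (letI := instX; iwasawaToIwasawaO S f • x) = f • x) (hιQ : ∀ (f : IwasawaAlgebra p) (x : DQ.X), (letI := instQ; iwasawaToIwasawaO S f • x) = f • x) (hCX : ∀ (a₁ : ↥(padicCoeffIntegers S)) (x : Dψ.X)
            (s₁ : SmallImageCharSignedSelmer.signedTransportSelmerInftySat (κ.restrictOfFinrankEqTwo hp K hK2) (GreenbergSelmer.Cofree θ (padicCoeffField S)) ↥(padicCoeffIntegers S) (W.baseChange K) j {w : HeightOneSpectrum (𝓞 K) | ∃ v ∈ S₀, ((natGenerator v : ℕ) : 𝓞 K) ∈ w.asIdeal} ε), Dψ.toDual (letI := instX; (PowerSeries.C a₁ : IwasawaAlgebraO S) • x) s₁ = Dψ.toDual x ⟨GreenbergSelmer.scalarH1 _ _ a₁ s₁,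
              SmallImageCharSignedSelmer.scalarH1_mem_signedTransportSelmerInftySat _ _ ↥(padicCoeffIntegers S) (W.baseChange K) j {w : HeightOneSpectrum (𝓞 K) | ∃ v ∈ S₀, ((natGenerator v : ℕ) : 𝓞 K) ∈ w.asIdeal} ε a₁ s₁.2⟩) (hCQ : ∀ (a₁ : ↥(padicCoeffIntegers S)) (x : DQ.X) (c : SmallImageRttD2Seq.localCondInftySat (κ.restrictOfFinrankEqTwo hp K hK2) (GreenbergSelmer.Cofree θ (padicCoeffField S)) ↥(padicCoeffIntegers S) (W.baseChange K) j ε vp),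
          DQ.toDual (letI := instQ; (PowerSeries.C a₁ : IwasawaAlgebraO S) • x) c = DQ.toDual x (SmallImageRttD2Seq.scalarLocalSat _ _ ↥(padicCoeffIntegers S) (W.baseChange K) j ε vp a₁ c)),
        letI := instX; letI := instQ ;
        haveI : IsScalarTower (IwasawaAlgebra p) (IwasawaAlgebraO S) Dψ.X := SmallImageRttCharRoad.isScalarTower_iwasawaAlgebraO_of_smul_eq S (fun _ ↦ rfl) hιX ;
        haveI : IsScalarTower (IwasawaAlgebra p) (IwasawaAlgebraO S) DQ.X := SmallImageRttCharRoad.isScalarTower_iwasawaAlgebraO_of_smul_eq S (fun _ ↦ rfl) hιQ ;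
        let gX := SmallImageRttD2Seq.gXLinearMapO S Dψ DQ (fun _ _ ↦ rfl) (SmallImageRttD2Seq.natCast_mem_asIdeal_of_eq_span hv) instX instQ hιX hιQ hCX hCQ (GreenbergSelmer.exists_pow_smul_cofree_eq_zero S θ) (GreenbergSelmer.isOpen_stabilizer_cofree S θ) (SmallImageRttD2Seq.isOpen_stabilizer_of_hres (GreenbergSelmer.Cofree θ (padicCoeffField S)) vp (fun _ _ ↦ rfl) (GreenbergSelmer.isOpen_stabilizer_cofree S θ)) hγK
              (SmallImageRttD2Seq.isNonsplitIn_restrictOfFinrankEqTwo hp hκ K hK2 hnd (SmallImageRttD2Seq.natCast_mem_asIdeal_of_eq_span hv)) hγv; (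
                  (@lambdaInvariant p _ (SmallImageRttD2Seq.strictSelmer (κ.restrictOfFinrankEqTwo hp K hK2) (GreenbergSelmer.Cofree θ (padicCoeffField S)) ↥(padicCoeffIntegers S) (W.baseChange K) j {w : HeightOneSpectrum (𝓞 K) | ∃ v ∈ S₀, ((natGenerator v : ℕ) : 𝓞 K) ∈ w.asIdeal} ε ({w : HeightOneSpectrum (𝓞 K) | ∃ v ∈ S₀, ((natGenerator v : ℕ) : 𝓞 K) ∈ w.asIdeal} ∪ {w : HeightOneSpectrum (𝓞 K) | ((p : ℕ) : 𝓞 K) ∈ w.asIdeal}) →+ AddCircle (1 : ℚ)) _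
                    (SmallImageRttD2Seq.strictDualModule (κ.restrictOfFinrankEqTwo hp K hK2) ↥(padicCoeffIntegers S) (W.baseChange K) j {w : HeightOneSpectrum (𝓞 K) | ∃ v ∈ S₀, ((natGenerator v : ℕ) : 𝓞 K) ∈ w.asIdeal} ε ({w : HeightOneSpectrum (𝓞 K) | ∃ v ∈ S₀, ((natGenerator v : ℕ) : 𝓞 K) ∈ w.asIdeal} ∪ {w : HeightOneSpectrum (𝓞 K) | ((p : ℕ) : 𝓞 K) ∈ w.asIdeal}) (GreenbergSelmer.exists_pow_smul_cofree_eq_zero S θ) (GreenbergSelmer.isOpen_stabilizer_cofree S θ) hγK))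
                  ) + lambdaInvariant p (IwasawaAlgebraO S ⧸ Ideal.span {(
                      (PowerSeries.C ((p : ↥(padicCoeffIntegers S)) ^ d) * ∏ w ∈ T, (iwasawaToIwasawaO S (PowerSeries.binomialSeries ℤ_[p] (x w)) - PowerSeries.C (((θ' (φ w) : (↥(padicCoeffIntegers S))ˣ) : ↥(padicCoeffIntegers S)) * padicIntToCoeffIntegers S ((GaloisRep.cyclotomicCharacter K p (φ w) : ℤ_[p]ˣ) : ℤ_[p]))))
                      )}) ≤ lambdaInvariant p (Dψ.X ⧸ LinearMap.range gX) + lambdaInvariant p (I.H ⧸ LinearMap.range (Submodule.subtype (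
                          (SmallImageRttD2Seq.strictCarrier I (SmallImageRttD2Seq.strictLevel S (κ.restrictOfFinrankEqTwo hp K hK2) θ' (Literature.NumberTheory.ComplexMultiplication.EllipticUnits.JohnsonLeungKings2011.suppPF p 𝔣) {w : HeightOneSpectrum (𝓞 K) | ∃ v ∈ S₀, ((natGenerator v : ℕ) : 𝓞 K) ∈ w.asIdeal})
                            (fun n k f _ hy ↦ SmallImageRttD2Seq.smul_mem_strictLevel S (κ.restrictOfFinrankEqTwo hp K hK2) θ' (Literature.NumberTheory.ComplexMultiplication.EllipticUnits.JohnsonLeungKings2011.suppPF p 𝔣) {w : HeightOneSpectrum (𝓞 K) | ∃ v ∈ S₀, ((natGenerator v : ℕ) : 𝓞 K) ∈ w.asIdeal} γK⁻¹ n k f hy)))))) := by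
    intro γv' hγv' DQ' instX' instQ' hιX' hιQ' hCX' hCQ' gX'
    have hraw := hS3b I T φ x d hT hφ hx
    have hle := SmallImageRttD2Seq.strictSelmer_le_strictAt (κ.restrictOfFinrankEqTwo hp K hK2) (GreenbergSelmer.Cofree θ (padicCoeffField S)) ↥(padicCoeffIntegers S)
      (W.baseChange K) j {w : HeightOneSpectrum (𝓞 K) | ∃ v ∈ S₀, ((natGenerator v : ℕ) : 𝓞 K) ∈ w.asIdeal} ε
      (S₁ := {w : HeightOneSpectrum (𝓞 K) | ∃ v ∈ S₀, ((natGenerator v : ℕ) : 𝓞 K) ∈ w.asIdeal} ∪ {w : HeightOneSpectrum (𝓞 K) | ((p : ℕ) : 𝓞 K) ∈ w.asIdeal})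
      (Set.mem_union_right _ hvp) hvp
    have h := SmallImageRttD2Seq.strictDual_add_le_coker_add_of_le_locImageDual_add S Dψ DQ' (fun _ _ ↦ rfl) hvp _ hle instX' instQ' hιX' hιQ' hCX' hCQ' hnon htorC hstabK hstab hγK hγv' htor
      (q := lambdaInvariant p (I.H ⧸ LinearMap.range (Submodule.subtype (
          (SmallImageRttD2Seq.strictCarrier I (SmallImageRttD2Seq.strictLevel S (κ.restrictOfFinrankEqTwo hp K hK2) θ' (Literature.NumberTheory.ComplexMultiplication.EllipticUnits.JohnsonLeungKings2011.suppPF p 𝔣) {w : HeightOneSpectrum (𝓞 K) | ∃ v ∈ S₀, ((natGenerator v : ℕ) : 𝓞 K) ∈ w.asIdeal})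
            (fun n k f _ hy ↦ SmallImageRttD2Seq.smul_mem_strictLevel S (κ.restrictOfFinrankEqTwo hp K hK2) θ' (Literature.NumberTheory.ComplexMultiplication.EllipticUnits.JohnsonLeungKings2011.suppPF p 𝔣) {w : HeightOneSpectrum (𝓞 K) | ∃ v ∈ S₀, ((natGenerator v : ℕ) : 𝓞 K) ∈ w.asIdeal} γK⁻¹ n k f hy)))))) hraw
    rw [add_comm] at h
    exact h
  have h3 := charRoadLambda_mono (hκ := hκ) (hnd := hnd) (hS := hS) (hv := hv) h3b hS3a
  have h3' := h3 γv hγv DQ instX instQ hιX hιQ hCX hCQ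
  refine ⟨jv ∘ₗ B'.subtype, Col.trans (LinearEquiv.smulOfUnit u), c * c', fv, mul_ne_zero hc hc', hfv, ?_, (hB' ▸ hexact), (hB' ▸ h3')⟩
  have h1 : (jv ∘ₗ B'.subtype) (s' (SmallImageRttD2Spec.zetaSp (PowerSeries.C (PowerSeries.X - PowerSeries.C (0 : ↥(padicCoeffIntegers S)) : PowerSeries ↥(padicCoeffIntegers S)) : Literature.NumberTheory.ComplexMultiplication.EllipticUnits.IwasawaAlgebraO₂ S) Dθ a)) =
      (PowerSeries.C ((p : ↥(padicCoeffIntegers S)) ^ d) * ∏ w ∈ T, (iwasawaToIwasawaO S (PowerSeries.binomialSeries ℤ_[p] (x w)) - PowerSeries.C (((θ' (φ w) : (↥(padicCoeffIntegers S))ˣ) : ↥(padicCoeffIntegers S)) * padicIntToCoeffIntegers S ((GaloisRep.cyclotomicCharacter K p (φ w) : ℤ_[p]ˣ) : ℤ_[p]))))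
      • jv (s (SmallImageRttD2Spec.zetaSp (PowerSeries.C (PowerSeries.X - PowerSeries.C (0 : ↥(padicCoeffIntegers S)) : PowerSeries ↥(padicCoeffIntegers S)) : Literature.NumberTheory.ComplexMultiplication.EllipticUnits.IwasawaAlgebraO₂ S) Dθ a)) := by
    rw [LinearMap.comp_apply, Submodule.subtype_apply, hs', map_smul]
  have h2 : ∀ y : DQ.X, (Col.trans (LinearEquiv.smulOfUnit u)) y = (u : IwasawaAlgebraO S) * Col y := fun y ↦ by
    rw [LinearEquiv.trans_apply]
    change (u : IwasawaAlgebraO S) • Col y = _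
    rw [smul_eq_mul]
  rw [h2, h1, map_smul, smul_eq_mul, ← mul_assoc, map_mul, hEuler, hrec, map_mul PowerSeries.C]
  ring
end Summit.BirchSwinnertonDyer.BirchSwinnertonDyer.Theorems.SmallImageRttLine

end
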